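import Literature.Topology.FourManifolds.KirbyCalculus
import Literature.Topology.FourManifolds.KirbyMovesStrictHandleSlide
import HarnessLib
import HarnessLib.Audit

/-!
# Property 2R and generalised Property R over strict handle slides (corrected spc4.S25)

`KirbyCalculus.lean` states Kirby's Problem 1.82 / Gompf–Scharlemann–Thompson's Conjecture 1 as
`Literature.Topology.FourManifolds.PropertyTwoRConjecture` and
`Literature.Topology.FourManifolds.GeneralizedPropertyRConjecture`, concluding with the prelude's
handle-slide equivalence `Literature.Topology.FourManifolds.IsHandleSlideEquivalent`. By the
erratum of 2026-08-14 (`KirbyMoves.lean`, `KirbyMovesStrictHandleSlide.lean`, module docstrings)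
that relation is **coarser** than the handle slides of the literature: its generating move
`FramedLink.IsHandleSlide` lets the band pass between the slid-over component and its framing
push-off, which is not a slide of the 2-handle and can change the surgered 3-manifold (the
`(0, 1)`-framed split unlink "slides" to a link with surgery `S³₀(6₁)`). Hence the two tree
statements are formally *weaker* than the printed conjectures (implied by them; a proof of the
tree statements would not settle the printed ones). This file vendors the printed conjectures over
the corrected move `Literature.Topology.FourManifolds.FramedLink.IsStrictHandleSlide` (band also
missing the collar annulus `Knot.TubularNbhd.collar ν`) under new names; nothing in
`KirbyCalculus.lean` is edited.

## What is printed

* Gompf–Scharlemann–Thompson (2010), §2, Conjecture 1 (Generalized Property R): "Suppose `L` is an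
  integrally framed link of `n ≥ 1` components in `S³`, and surgery on `L` via the specified
  framing yields `#ₙ(S¹ × S²)`. Then there is a sequence of handle slides on `L` that converts `L`
  into a `0`-framed unlink." The slide is the 2-handle slide of §2 ("The 4-manifold trace of the
  surgery on `L` is unchanged if one 2-handle is slid over another 2-handle … the effect on the
  link is to replace `U` by the band sum `Ū` of `U` with … the copy given by the preferred
  cross-section realizing the framing of `V` … the integer for `Ū` will be `m + n ± 2·link(U, V)`"),
  both signs (handle addition and subtraction).
* Kirby (1997), Problem 1.82, as quoted by GST §1: "If surgery on an `n`-component link `L` yields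
  the connected sum `#ₙ S¹ × S²` then `L` becomes the unlink after suitable handle slides."
* Property 2R is the case `n = 2` (GST §1; a knot "has Property 2R" if it is not a component of a
  2-component counterexample, GST Def. 2.4).

## This file

* `StrictHandleSlideMove`, `IsStrictHandleSlideEquivalent` — the handle-slide calculus without
  blow-ups, generated by ambient isotopy, renumbering, reversing a component (framed links are
  unoriented; reversal turns handle addition into subtraction) and STRICT handle slides
  (`FramedLink.IsStrictHandleSlide`); every strict move is a `HandleSlideMove` and a
  `StrictKirbyMove`, so the relation refines both `IsHandleSlideEquivalent` and
  `StrictKirbyEquivalent`.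
* `StrictPropertyTwoRConjecture`, `StrictGeneralizedPropertyRConjecture` — the printed conjectures
  (open; `def … : Prop`, never asserted), verbatim the tree statements with
  `IsStrictHandleSlideEquivalent` in place of `IsHandleSlideEquivalent`; they imply the tree
  statements (`propertyTwoRConjecture_of_strict`, `generalizedPropertyRConjecture_of_strict`), and
  the general conjecture contains Property 2R (`strictPropertyTwoRConjecture_of_strictGeneralized`).

Deliberately NOT here: the stable / weak versions (distant `0`-framed unlinks, cancelling Hopf
pairs — GST §9, Conjecture 4), which need a stabilisation API for `FramedLink`.

## References

* R. E. Gompf, M. Scharlemann, A. Thompson, *Fibered knots and potential counterexamples to the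
  Property 2R and Slice-Ribbon Conjectures*, Geom. Topol. 14 (2010) 2305–2347, §1, §2 (Conj. 1,
  Def. 2.4). [GompfScharlemannThompson2010]
* R. Kirby (ed.), *Problems in low-dimensional topology* (1997), Problem 1.82. [Kirby1997]
* R. C. Kirby, *The Topology of 4-Manifolds*, LNM 1374 (1989), Ch. I §4–§5. [Kirby1989]
-/

open scoped Manifold ContDiff
open Function Set

noncomputable section

namespace Literature.Topology.FourManifolds

/-- Local notation: `𝔼 n` is the model Euclidean space `EuclideanSpace ℝ (Fin n)`. -/
local notation "𝔼 " n:arg => EuclideanSpace ℝ (Fin n)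

/-! ### The handle-slide calculus with strict slides -/

/-- The **handle-slide moves with strict slides**: the Kirby moves without blow-downs —
ambient isotopy of framed links, renumbering the components, reversing the orientation of one
component (framed links are unoriented; sliding over the reversed component is handle
*subtraction*), and the printed 2-handle slide `FramedLink.IsStrictHandleSlide` (band sum with
the framing push-off along a band missing the other components AND the collar annulus between
the slid-over component and its push-off). This is `HandleSlideMove` of `KirbyMoves.lean` with the
strict slide in place of the permissive `FramedLink.IsHandleSlide` (erratum of 2026-08-14).
Gompf–Scharlemann–Thompson (2010), §2 ("such a handle slide is one of several moves allowed in
the Kirby calculus"; framing `m + n ± 2·link(U, V)`); Kirby (1989), Ch. I §4.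
[cite: GompfScharlemannThompson2010, §2] -/
inductive StrictHandleSlideMove [SphereEmbedding.SmoothnessFacts]
    [Knot.TubularNbhd.SmoothnessFacts] : FramedLinkFin → FramedLinkFin → Prop
  /-- Isotopic framed links are related. -/
  | isotopy {n : ℕ} {L L' : FramedLink (Fin n)} (h : L.IsIsotopic L') :
      StrictHandleSlideMove ⟨n, L⟩ ⟨n, L'⟩
  /-- Renumbering the components. -/
  | reindex {n : ℕ} (e : Fin n ≃ Fin n) (L : FramedLink (Fin n)) :
      StrictHandleSlideMove ⟨n, L⟩ ⟨n, L.reindex e⟩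
  /-- Reversing the orientation of one component. -/
  | reverseComponent {n : ℕ} (i : Fin n) (L : FramedLink (Fin n)) :
      StrictHandleSlideMove ⟨n, L⟩ ⟨n, L.reverseComponent i⟩
  /-- K2: a strict handle slide (band missing the other components and the collar annulus). -/
  | handleSlide {n : ℕ} {L L' : FramedLink (Fin n)} (h : L.IsStrictHandleSlide L') :
      StrictHandleSlideMove ⟨n, L⟩ ⟨n, L'⟩

/-- **Handle-slide equivalence with strict slides**: the equivalence relation generated by
`StrictHandleSlideMove` ("a sequence of handle slides", isotopies and renumberings understood,
both handle addition and subtraction). Gompf–Scharlemann–Thompson (2010), §2.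
[cite: GompfScharlemannThompson2010, §2] -/
def IsStrictHandleSlideEquivalent [SphereEmbedding.SmoothnessFacts]
    [Knot.TubularNbhd.SmoothnessFacts] : FramedLinkFin → FramedLinkFin → Prop :=
  Relation.EqvGen StrictHandleSlideMove

section Moves

variable [SphereEmbedding.SmoothnessFacts] [Knot.TubularNbhd.SmoothnessFacts]

/-- Handle-slide equivalence with strict slides is an equivalence relation (`Relation.EqvGen`).
[folklore] -/
theorem equivalence_isStrictHandleSlideEquivalent : Equivalence IsStrictHandleSlideEquivalent :=
  Relation.EqvGen.is_equivalence _

/-- A strict handle-slide move is a strict handle-slide equivalence. [folklore] -/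
theorem StrictHandleSlideMove.isStrictHandleSlideEquivalent {L L' : FramedLinkFin}
    (h : StrictHandleSlideMove L L') : IsStrictHandleSlideEquivalent L L' :=
  Relation.EqvGen.rel _ _ h

/-- A strict handle-slide move is a handle-slide move in the (permissive) sense of
`KirbyMoves.lean` (`FramedLink.IsStrictHandleSlide.isHandleSlide`). [folklore] -/
theorem StrictHandleSlideMove.handleSlideMove {L L' : FramedLinkFin}
    (h : StrictHandleSlideMove L L') : HandleSlideMove L L' := by
  cases h with
  | isotopy h => exact HandleSlideMove.isotopy h
  | reindex e L => exact HandleSlideMove.reindex e L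
  | reverseComponent i L => exact HandleSlideMove.reverseComponent i L
  | handleSlide h => exact HandleSlideMove.handleSlide h.isHandleSlide

/-- A strict handle-slide move is a strict Kirby move (`KirbyMovesStrictHandleSlide.lean`).
[folklore] -/
theorem StrictHandleSlideMove.strictKirbyMove {L L' : FramedLinkFin}
    (h : StrictHandleSlideMove L L') : StrictKirbyMove L L' := by
  cases h with
  | isotopy h => exact StrictKirbyMove.isotopy h
  | reindex e L => exact StrictKirbyMove.reindex e L
  | reverseComponent i L => exact StrictKirbyMove.reverseComponent i L
  | handleSlide h => exact StrictKirbyMove.handleSlide h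

/-- Strict handle-slide equivalence refines the permissive handle-slide equivalence
`IsHandleSlideEquivalent` of `KirbyMoves.lean`. [folklore] -/
theorem IsStrictHandleSlideEquivalent.isHandleSlideEquivalent {L L' : FramedLinkFin}
    (h : IsStrictHandleSlideEquivalent L L') : IsHandleSlideEquivalent L L' :=
  Relation.EqvGen.mono (fun _ _ (h : StrictHandleSlideMove _ _) ↦ h.handleSlideMove) L L' h

/-- Strict handle-slide equivalence refines strict Kirby equivalence (no blow-ups are used).
[folklore] -/
theorem IsStrictHandleSlideEquivalent.strictKirbyEquivalent {L L' : FramedLinkFin}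
    (h : IsStrictHandleSlideEquivalent L L') : StrictKirbyEquivalent L L' :=
  Relation.EqvGen.mono (fun _ _ (h : StrictHandleSlideMove _ _) ↦ h.strictKirbyMove) L L' h

/-- Hence strict handle-slide equivalence also refines the permissive Kirby equivalence
`KirbyEquivalent`. [folklore] -/
theorem IsStrictHandleSlideEquivalent.kirbyEquivalent {L L' : FramedLinkFin}
    (h : IsStrictHandleSlideEquivalent L L') : KirbyEquivalent L L' :=
  h.isHandleSlideEquivalent.kirbyEquivalent

end Moves

/-! ### The printed conjectures (open) -/

variable [SphereEmbedding.SmoothnessFacts] in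
variable [Knot.TubularNbhd.SmoothnessFacts] in
/-- **Property 2R conjecture, printed form** (Kirby (1997), Problem 1.82, case `n = 2`;
Gompf–Scharlemann–Thompson (2010), §1 and §2 Conjecture 1 with `n = 2`): if surgery on a
`2`-component framed link `L ⊆ S³` yields `(S² × S¹) # (S² × S¹)`, then a sequence of handle
slides (2-handle slides: band sums with the framing push-off, framing `m + n ± 2·lk`;
isotopies, renumbering and reversal of components understood) converts `L` into the `0`-framed
two-component unlink. Verbatim `Literature.Topology.FourManifolds.PropertyTwoRConjecture` with the
strict handle-slide equivalence `IsStrictHandleSlideEquivalent` in place of the permissive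
`IsHandleSlideEquivalent` (erratum of 2026-08-14: the latter admits moves that are not handle
slides, making the tree statement formally weaker than the printed one). Open; a `Prop`, not
asserted. GST conjecture that it FAILS for the square knot (their Conjecture 3).
[cite: GompfScharlemannThompson2010, §2 Conjecture 1] -/
@[conjecture] def StrictPropertyTwoRConjecture : Prop :=
  ∀ (L : FramedLink (Fin 2)) (Y : Type) [TopologicalSpace Y] [T2Space Y]
    [SecondCountableTopology Y] [ChartedSpace (𝔼 3) Y] [IsManifold (𝓡 3) ∞ Y] [CompactSpace Y]
    [ConnectedSpace Y],
    IsSphereTwoProdCircleSum 2 Y → L.IsSurgery (𝓡 3) Y →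
      ∃ U : FramedLink (Fin 2), U.IsZeroFramedUnlink ∧ IsStrictHandleSlideEquivalent ⟨2, L⟩ ⟨2, U⟩

variable [SphereEmbedding.SmoothnessFacts] in
variable [Knot.TubularNbhd.SmoothnessFacts] in
/-- **Generalised Property R conjecture, printed form** (Gompf–Scharlemann–Thompson (2010), §2,
Conjecture 1: "Suppose `L` is an integrally framed link of `n ≥ 1` components in `S³`, and
surgery on `L` via the specified framing yields `#ₙ(S¹ × S²)`. Then there is a sequence of handle
slides on `L` that converts `L` into a `0`-framed unlink."; Kirby (1997), Problem 1.82). Verbatim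
`Literature.Topology.FourManifolds.GeneralizedPropertyRConjecture` with `IsStrictHandleSlideEquivalent`
in place of `IsHandleSlideEquivalent` (erratum of 2026-08-14). The case `n = 0` is vacuous-true
content (`Y ≅ S³`, empty link) and `n = 1` is Gabai's Property R; GST "conclude that the
conjecture is probably false" (§1). Open; a `Prop`, not asserted.
[cite: GompfScharlemannThompson2010, §2 Conjecture 1] -/
@[conjecture] def StrictGeneralizedPropertyRConjecture : Prop :=
  ∀ (n : ℕ) (L : FramedLink (Fin n)) (Y : Type) [TopologicalSpace Y] [T2Space Y]
    [SecondCountableTopology Y] [ChartedSpace (𝔼 3) Y] [IsManifold (𝓡 3) ∞ Y] [CompactSpace Y]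
    [ConnectedSpace Y],
    IsSphereTwoProdCircleSum n Y → L.IsSurgery (𝓡 3) Y →
      ∃ U : FramedLink (Fin n), U.IsZeroFramedUnlink ∧ IsStrictHandleSlideEquivalent ⟨n, L⟩ ⟨n, U⟩

section Consequences

variable [SphereEmbedding.SmoothnessFacts] [Knot.TubularNbhd.SmoothnessFacts]

/-- The printed generalised Property R conjecture (all `n`) contains the printed Property 2R
(`n = 2`). [folklore] -/
theorem strictPropertyTwoRConjecture_of_strictGeneralized
    (h : StrictGeneralizedPropertyRConjecture) : StrictPropertyTwoRConjecture :=
  fun L Y _ _ _ _ _ _ _ hY hL ↦ h 2 L Y hY hL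

/-- The printed Property 2R implies the tree's (permissive, formally weaker) statement
`PropertyTwoRConjecture`, since strict handle-slide equivalence refines `IsHandleSlideEquivalent`.
[folklore] -/
theorem propertyTwoRConjecture_of_strict (h : StrictPropertyTwoRConjecture) :
    PropertyTwoRConjecture := by
  intro L Y _ _ _ _ _ _ _ hY hL
  obtain ⟨U, hU, hLU⟩ := h L Y hY hL
  exact ⟨U, hU, hLU.isHandleSlideEquivalent⟩

/-- The printed generalised Property R conjecture implies the tree's (permissive, formally
weaker) statement `GeneralizedPropertyRConjecture`. [folklore] -/
theorem generalizedPropertyRConjecture_of_strict (h : StrictGeneralizedPropertyRConjecture) :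
    GeneralizedPropertyRConjecture := by
  intro n L Y _ _ _ _ _ _ _ hY hL
  obtain ⟨U, hU, hLU⟩ := h n L Y hY hL
  exact ⟨U, hU, hLU.isHandleSlideEquivalent⟩

/-- Contrapositive bookkeeping: a refutation of the tree's permissive `PropertyTwoRConjecture`
refutes the printed conjecture. [folklore] -/
theorem not_strictPropertyTwoRConjecture_of_not (h : ¬ PropertyTwoRConjecture) :
    ¬ StrictPropertyTwoRConjecture :=
  fun hs ↦ h (propertyTwoRConjecture_of_strict hs)

end Consequences

end Literature.Topology.FourManifolds

end
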